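import Summits.BirchSwinnertonDyer.BirchSwinnertonDyer.Theorems.PrintCf2RamifiedOffTYZPartnerShaSelmerR2
import Summits.BirchSwinnertonDyer.BirchSwinnertonDyer.Theorems.PrintCf2RamifiedOffTYZPartnerShaRigidity
import HarnessLib

/-!
# Crux `PrintCf2.RamifiedOffTYZOfFacts` (stmt-BirchSwinnertonDyer-20509), line `offtyz-v7`, LEAD cycle 21 (cruxlead-20509 g20), part 6/6:
# THE `φ`-SELMER GROUP ON R2 — `S(0, 4l²q²) = {1, 2, l, 2l}`, `dim S' = 2` — AND THE HEADLINE ON R2 BY NAME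

THEOREMS ONLY (no `def`, no named fact introduced, no `sorry`), `--supports stmt-BirchSwinnertonDyer-20509`.  Same setting as part 5 (R2: `l ≡ 1`,
`q ≡ 7 (mod 8)`, `(l/q) = (q/l) = 1`).

* §9 (second half) `not_isSquare_neg_four_mul_sq`, `eq_of_squarefree_dvd_R2`, **`twoIsogenySelmerGroup'_R2` : `S(0, 4l²q²) = {1, 2, l, 2l}`** (members
  `1, l, 2` and `2l` by the group law; a member is positive (real place) and prime to `q` (the `q`-adic obstruction with `d₁e₁ = 4l²`, `−4l²` a
  non-residue mod `q ≡ 3 (4)`)), **`twoIsogenySelmerRank'_R2` : `dim S'(0, −l²q²) = 2`** — the census sentence «`Sel^{(φ)}(A_n) = {1, 2, l, 2l}` on R2»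
  (cruxlead g15 §3 / g16 §4) as a theorem.
* §10 **`rhoIndex_ne_one_and_selmerFour_of_partner_R2`** (T1 on R2, CT-free): `rank E_{lq} = 1 ∧ #Sel₂ = 2⁵ ∧ Ш(A_{lq})[2] = 0 ⟹ ρ(lq) ≠ 0 ∧
  #Ш(E_{lq})[2^∞] = 4 ∧ #Sel₄(E_{lq}) = 2⁶`; **`partner_sha_two_eq_bot_iff_R2`** (GZK + `exists_casselsTate_pairing_adjoint ℚ` by name, the ONLY named
  inputs left): on R2 with `ord_{s=1} L(E_{lq}, s) = 1`, `#Sel₂ = 2⁵`: **`Ш(A_{lq})[2] = 0 ⟺ ρ(lq) ≠ 0 ∧ #Sel₄(E_{lq}) = 2⁶`**.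

What this buys the line (LEAD census, crux 20509; memo `Lines/offtyz_v7_PartnerSha.md`): the `Sel₄` hypothesis of C⁺ on R2 is now, by theorems, the pair
(«`ρ(lq) = 1`», «`Ш(A_{lq})[2] = 0`» ⟺ «`dim Sel₂(A_{lq}/ℚ) = 2`»); g15's census law RhoLawR2 («`ρ = 1 ⟺ l ≠ x² + 32y²`», 636/636 on G) is thereby
equivalent on G to the Selmer law «`Ш(A_{lq})[2] = 0 ⟺ ((1+i)/π_l)₂ = −1`» (F1), the one remaining descent input.  The analytic half of C⁺ (`2 ∥ 𝓛`)
is untouched — conjecture-grade (p770400).  Beyond-print theorem: NO.  BSD is not proved by any of this; C⁺ (23431) and the crux (20509) stay OPEN.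

References: [cite: SilvermanAEC2009, Thm. X.4.2(a), Prop. X.4.9, Example X.4.10]; [cite: MilneADT2006, Ch. I, Thm. 6.13(a), Rem. 6.10(a)];
[cite: Darmon2004, Thm. 3.22]; [cite: TianYuanZhang2017, §1 (ρ(n), A_n)]; tree: parts 1–5 (`…PartnerSha{Cassels,Rho,Rigidity,DiagonalQuartics,SelmerR2}`).
-/

noncomputable section

open scoped Classical

open WeierstrassCurve Literature.NumberTheory Literature.NumberTheory.EllipticCurves Literature.NumberTheory.DiophantineGeometry
  Literature.NumberTheory.DiophantineGeometry.LindMordellQuartics Literature.NumberTheory.EllipticCurves.TianYuanZhang2017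

namespace Summit.BirchSwinnertonDyer.PrintCf2.PartnerSha

/-- `b / d = d'` from `d · d' = b`. [folklore] -/
private theorem ediv_eq_of_mul_eq_left {b d d' : ℤ} (hd : d ≠ 0) (h : d * d' = b) : b / d = d' := by
  rw [← h, Int.mul_ediv_cancel_left _ hd]

section R2'

variable {l q : ℕ} [hlp : Fact l.Prime] [hqp : Fact q.Prime]

/-- `−4l²` is not a square modulo a prime `q ≡ 3 (mod 4)` not dividing `2l`. [folklore] -/
theorem not_isSquare_neg_four_mul_sq (hq4 : q % 4 = 3) (hq2 : q ≠ 2) (hlq_ne : l ≠ q) :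
    ¬ IsSquare (((-(4 * (l : ℤ) ^ 2)) : ℤ) : ZMod q) := by
  have hq := hqp.out
  have hl := hlp.out
  rintro ⟨r, hr⟩
  have h2l : (2 * (l : ZMod q)) ≠ 0 := by
    intro h0
    rcases mul_eq_zero.mp h0 with h | h
    · have : ((2 : ℕ) : ZMod q) = 0 := by exact_mod_cast h
      rw [ZMod.natCast_eq_zero_iff] at this
      exact hq2 ((Nat.prime_dvd_prime_iff_eq hq Nat.prime_two).mp this)
    · rw [ZMod.natCast_eq_zero_iff] at h
      exact hlq_ne ((Nat.prime_dvd_prime_iff_eq hq hl).mp h).symm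
  apply (ZMod.exists_sq_eq_neg_one_iff (p := q)).mp _ (by omega)
  set u : ZMod q := (2 * (l : ZMod q))⁻¹ with hu
  have hinv : 2 * (l : ZMod q) * u = 1 := mul_inv_cancel₀ h2l
  refine ⟨r * u, ?_⟩
  push_cast at hr
  linear_combination u ^ 2 * hr + (2 * (l : ZMod q) * u + 1) * hinv

/-- Positive squarefree divisors of `4l²q²` prime to `q` are `1, 2, l, 2l`. [folklore] -/
theorem eq_of_squarefree_dvd_R2 (hl2 : l ≠ 2) {d : ℤ} (hd0 : 0 < d) (hsq : Squarefree d)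
    (hdvd : d ∣ 4 * (l : ℤ) ^ 2 * (q : ℤ) ^ 2) (hqd : ¬ (q : ℤ) ∣ d) :
    d = 1 ∨ d = 2 ∨ d = l ∨ d = 2 * l := by
  have hl := hlp.out
  have hq := hqp.out
  -- `d ∣ (2lq)²` squarefree ⟹ `d ∣ 2lq` ⟹ (coprime to `q`) `d ∣ 2l`
  have h1 : d ∣ (2 * (l : ℤ) * q) ^ 2 := by rw [show (2 * (l : ℤ) * q) ^ 2 = 4 * (l : ℤ) ^ 2 * (q : ℤ) ^ 2 by ring]; exact hdvd
  rw [hsq.dvd_pow_iff_dvd two_ne_zero] at h1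
  have hqi : Prime (q : ℤ) := Nat.prime_iff_prime_int.mp hq
  have hcop : IsCoprime d (q : ℤ) := ((Prime.coprime_iff_not_dvd hqi).mpr hqd).symm
  have h2 : d ∣ 2 * (l : ℤ) := hcop.dvd_of_dvd_mul_right h1
  -- pass to `ℕ`
  obtain ⟨e, rfl⟩ : ∃ e : ℕ, d = (e : ℤ) := ⟨d.natAbs, by rw [Int.natAbs_of_nonneg hd0.le]⟩
  have h3 : e ∣ 2 * l := by exact_mod_cast h2
  obtain ⟨a, b, ha, hb, rfl⟩ := Nat.dvd_mul.mp h3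
  rcases (Nat.dvd_prime Nat.prime_two).mp ha with rfl | rfl <;>
    rcases (Nat.dvd_prime hl).mp hb with rfl | rfl <;> simp

/-- **`Sel^{(φ)}(E_{lq} → A_{lq}) = {1, 2, l, 2l}` on R2** (the descent on the divisors of `a² − 4b = 4l²q²`): `1, l, 2` lie in it
(`l`: `isLocallySoluble_l_class_R2`; `2`: `isLocallySoluble_two_class_R2`) and so does `2l` (group law); a member is positive
(the real place) and prime to `q` (the `q`-adic obstruction: `d = q d₁`, `4l²q²/d = q e₁`, `d₁e₁ = 4l²`, `−4l²` a non-residue mod `q ≡ 3 (4)`),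
hence one of `1, 2, l, 2l`. This is the sentence «`Sel^{(φ)}(A_n) = {1, 2, l, 2l}` on R2» of the lineage's census memos (g15 §3, g16 §4),
now a theorem. [cite: SilvermanAEC2009, Prop. X.4.9, Example X.4.10] [cite: TianYuanZhang2017, §1 (A_n)] -/
theorem twoIsogenySelmerGroup'_R2 (hl8 : l % 8 = 1) (hq8 : q % 8 = 7)
    (hlq : IsSquare ((l : ℤ) : ZMod q)) (hql : IsSquare ((q : ℤ) : ZMod l)) :
    twoIsogenySelmerGroup 0 (4 * (l : ℤ) ^ 2 * (q : ℤ) ^ 2) = {1, 2, (l : ℤ), 2 * (l : ℤ)} := by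
  have hl := hlp.out
  have hq := hqp.out
  have hlq_ne : l ≠ q := by rintro rfl; omega
  have hl2 : l ≠ 2 := by rintro rfl; omega
  have hq2 : q ≠ 2 := by rintro rfl; omega
  have hl0 : (l : ℤ) ≠ 0 := by exact_mod_cast hl.ne_zero
  have hq0 : (q : ℤ) ≠ 0 := by exact_mod_cast hq.ne_zero
  set B : ℤ := 4 * (l : ℤ) ^ 2 * (q : ℤ) ^ 2 with hBdef
  have hBpos : 0 < B := by positivity
  have hB : B ≠ 0 := hBpos.ne'
  have hab : B * ((0 : ℤ) ^ 2 - 4 * B) ≠ 0 := by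
    have : (0 : ℤ) ^ 2 - 4 * B = -(4 * B) := by ring
    rw [this]; exact mul_ne_zero hB (neg_ne_zero.mpr (by positivity))
  have hsq2 : Squarefree (2 : ℤ) := Int.squarefree_natCast.mpr Nat.prime_two.prime.squarefree
  have hsql : Squarefree (l : ℤ) := Int.squarefree_natCast.mpr hl.prime.squarefree
  have hsq2l : Squarefree (2 * (l : ℤ)) := by
    have : Squarefree (2 * l) :=
      Nat.squarefree_mul_iff.mpr ⟨(Nat.coprime_primes Nat.prime_two hl).mpr (Ne.symm hl2),
        Nat.prime_two.prime.squarefree, hl.prime.squarefree⟩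
    exact_mod_cast Int.squarefree_natCast.mpr this
  -- the four members
  have m1 : (1 : ℤ) ∈ twoIsogenySelmerGroup 0 B := one_mem_twoIsogenySelmerGroup 0 hB
  have ml : (l : ℤ) ∈ twoIsogenySelmerGroup 0 B := by
    rw [mem_twoIsogenySelmerGroup_iff hB]
    refine ⟨hsql, ⟨4 * l * (q : ℤ) ^ 2, by rw [hBdef]; ring⟩, ?_⟩
    rw [ediv_eq_of_mul_eq_left hl0 (d' := 4 * l * (q : ℤ) ^ 2) (by rw [hBdef]; ring), twoIsogenyQuartic_zero]
    exact isLocallySoluble_l_class_R2 hl8 hq8 hlq hql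
  have m2 : (2 : ℤ) ∈ twoIsogenySelmerGroup 0 B := by
    rw [mem_twoIsogenySelmerGroup_iff hB]
    refine ⟨hsq2, ⟨2 * (l : ℤ) ^ 2 * (q : ℤ) ^ 2, by rw [hBdef]; ring⟩, ?_⟩
    rw [ediv_eq_of_mul_eq_left two_ne_zero (d' := 2 * (l : ℤ) ^ 2 * (q : ℤ) ^ 2) (by rw [hBdef]; ring),
      twoIsogenyQuartic_zero]
    exact isLocallySoluble_two_class_R2 (l := l) (q := q) hl8 hq8
  have m2l : (2 * (l : ℤ)) ∈ twoIsogenySelmerGroup 0 B := by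
    obtain ⟨d₃, hd₃, m, hm0, hm⟩ := exists_mem_twoIsogenySelmerGroup_of_mul_mem hab m2 ml
    have hsq₃ := squarefree_of_mem_twoIsogenySelmerGroup hd₃
    have h : 2 * (l : ℤ) * d₃ = (m * d₃) ^ 2 := by
      calc 2 * (l : ℤ) * d₃ = (m ^ 2 * d₃) * d₃ := by rw [← hm]
        _ = (m * d₃) ^ 2 := by ring
    rwa [eq_of_squarefree_of_mul_eq_sq hsq2l hsq₃ h]
  -- the exclusions
  have hexcl : ∀ d ∈ twoIsogenySelmerGroup 0 B, 0 < d ∧ ¬ (q : ℤ) ∣ d := by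
    intro d hd
    rw [mem_twoIsogenySelmerGroup_iff hB] at hd
    obtain ⟨hsq, hdvd, hloc⟩ := hd
    have hd0 : d ≠ 0 := hsq.ne_zero
    have hmul : d * (B / d) = B := Int.mul_ediv_cancel' hdvd
    have hpos : 0 < d := by
      by_contra hle
      have hneg : d < 0 := lt_of_le_of_ne (not_lt.mp hle) hd0
      have hBd : B / d < 0 := by nlinarith
      exact not_isSoluble_real_twoIsogenyQuartic_of_neg hneg hBd le_rfl hloc.1
    refine ⟨hpos, fun hqd => ?_⟩
    obtain ⟨d₁, rfl⟩ := hqd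
    have hqi : Prime (q : ℤ) := Nat.prime_iff_prime_int.mp hq
    have hqd₁ : ¬ (q : ℤ) ∣ d₁ := by
      rintro ⟨c, rfl⟩
      exact hqi.not_unit (isUnit_of_dvd_unit (dvd_refl _) (hsq (q : ℤ) ⟨c, by ring⟩))
    -- `d₁ ∣ 4l²`
    have h1 : (q : ℤ) * d₁ ∣ (4 * (l : ℤ) ^ 2) * q * q := by rw [hBdef] at hdvd; simpa [mul_comm, mul_assoc, mul_left_comm, sq] using hdvd
    have h2 : d₁ ∣ (4 * (l : ℤ) ^ 2) * q := by
      have : (q : ℤ) * d₁ ∣ (q : ℤ) * ((4 * (l : ℤ) ^ 2) * q) := by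
        simpa [mul_comm, mul_assoc, mul_left_comm] using h1
      exact (mul_dvd_mul_iff_left hq0).mp this
    have hcop : IsCoprime d₁ (q : ℤ) := ((Prime.coprime_iff_not_dvd hqi).mpr hqd₁).symm
    obtain ⟨e₁, he₁⟩ : d₁ ∣ 4 * (l : ℤ) ^ 2 := hcop.dvd_of_dvd_mul_right h2
    have hd₁0 : d₁ ≠ 0 := right_ne_zero_of_mul hd0
    have hBd : B / ((q : ℤ) * d₁) = q * e₁ :=
      ediv_eq_of_mul_eq_left hd0 (by rw [hBdef, he₁]; ring)
    have hns : ¬ IsSquare (((-(d₁ * e₁)) : ℤ) : ZMod q) := by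
      rw [show d₁ * e₁ = 4 * (l : ℤ) ^ 2 from he₁.symm]
      exact not_isSquare_neg_four_mul_sq (l := l) (q := q) (by omega) hq2 hlq_ne
    rw [hBd, twoIsogenyQuartic_zero] at hloc
    exact not_isSoluble_padic_diag_of_dvd_both hns (hloc.2 q)
  -- assembly
  ext d
  simp only [Finset.mem_insert, Finset.mem_singleton]
  constructor
  · intro hd
    have hd' := hd
    rw [mem_twoIsogenySelmerGroup_iff hB] at hd'
    obtain ⟨hpos, hqd⟩ := hexcl d hd
    exact eq_of_squarefree_dvd_R2 (l := l) (q := q) hl2 hpos hd'.1 hd'.2.1 hqd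
  · rintro (rfl | rfl | rfl | rfl)
    · exact m1
    · exact m2
    · exact ml
    · exact m2l

/-- **`dim S'(0, −l²q²) = 2` on R2** (`Sel^{(φ)}(E_{lq} → A_{lq}) = {1, 2, l, 2l}` has order `4`). [cite: SilvermanAEC2009, Prop. X.4.9] -/
theorem twoIsogenySelmerRank'_R2 (hl8 : l % 8 = 1) (hq8 : q % 8 = 7)
    (hlq : IsSquare ((l : ℤ) : ZMod q)) (hql : IsSquare ((q : ℤ) : ZMod l)) :
    twoIsogenySelmerRank' 0 (-(((l * q : ℕ) : ℤ)) ^ 2) = 2 := by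
  have hl := hlp.out
  have hl2 : l ≠ 2 := by rintro rfl; omega
  have heq : twoIsogenySelmerRank' 0 (-(((l * q : ℕ) : ℤ)) ^ 2) =
      twoIsogenySelmerRank 0 (4 * (l : ℤ) ^ 2 * (q : ℤ) ^ 2) := by
    rw [twoIsogenySelmerRank', show (-2 * 0 : ℤ) = 0 by norm_num,
      show (0 : ℤ) ^ 2 - 4 * (-(((l * q : ℕ) : ℤ)) ^ 2) = 4 * (l : ℤ) ^ 2 * (q : ℤ) ^ 2 by push_cast; ring]
  rw [heq, twoIsogenySelmerRank, twoIsogenySelmerGroup'_R2 hl8 hq8 hlq hql]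
  have hl1 : (1 : ℤ) < l := by exact_mod_cast hl.one_lt
  have h2l : (2 : ℤ) ≠ l := by intro h; exact hl2 (by exact_mod_cast h.symm)
  rw [Finset.card_insert_of_notMem (by simp only [Finset.mem_insert, Finset.mem_singleton]; omega),
    Finset.card_insert_of_notMem (by simp only [Finset.mem_insert, Finset.mem_singleton]; omega),
    Finset.card_insert_of_notMem (by simp only [Finset.mem_singleton]; omega), Finset.card_singleton]
  exact Nat.log_pow Nat.one_lt_two 2

end R2'

/-! ## §10 The headline on R2 by name: only GZK and the Cassels–Tate fact remain as named inputs -/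

section R2Headline

variable {l q : ℕ} [hlp : Fact l.Prime] [hqp : Fact q.Prime]

/-- `n = lq` on R2 is square-free and `> 1`. [folklore] -/
theorem squarefree_and_one_lt_R2 (hlq_ne : l ≠ q) : Squarefree (l * q) ∧ 1 < l * q := by
  have hl := hlp.out
  have hq := hqp.out
  exact ⟨Nat.squarefree_mul_iff.mpr ⟨(Nat.coprime_primes hl hq).mpr hlq_ne, hl.prime.squarefree, hq.prime.squarefree⟩,
    lt_of_lt_of_le hl.one_lt (Nat.le_mul_of_pos_right _ hq.pos)⟩

/-- **T1 ON R2 (no Cassels–Tate, no GZK beyond the rank): a `2`-torsion-free partner forces `ρ(lq) = 1` and the jump-one condition.**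
For primes `l ≡ 1`, `q ≡ 7 (mod 8)` with `(l/q) = (q/l) = 1`, `rank E_{lq}(ℚ) = 1`, `#Sel₂(E_{lq}) = 2⁵`: `Ш(A_{lq})[2] = 0 ⟹ ρ(lq) ≠ 0 ∧
#Ш(E_{lq})[2^∞] = 4 ∧ #Sel₄(E_{lq}) = 2⁶` (`dim S' = 2` is now the theorem `twoIsogenySelmerRank'_R2`). [cite: SilvermanAEC2009, Thm. X.4.2(a), Prop. X.4.9]
[cite: TianYuanZhang2017, §1 (ρ(n))] -/
theorem rhoIndex_ne_one_and_selmerFour_of_partner_R2 (hl8 : l % 8 = 1) (hq8 : q % 8 = 7)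
    (hlq : IsSquare ((l : ℤ) : ZMod q)) (hql : IsSquare ((q : ℤ) : ZMod l))
    (hr : haveI := isElliptic_congruentNumberCurve (Nat.mul_ne_zero hlp.out.ne_zero hqp.out.ne_zero);
      (congruentNumberCurve (l * q)).mordellWeilRank = 1)
    (h₂ : haveI := isElliptic_congruentNumberCurve (Nat.mul_ne_zero hlp.out.ne_zero hqp.out.ne_zero);
      Nat.card ((congruentNumberCurve (l * q)).selmerGroup 2) = 2 ^ 5)
    (hA : ∀ c ∈ (congruentNumberCurve (l * q)).twoIsogenyCodomain.sha, 2 • c = 0 → c = 0) :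
    haveI := isElliptic_congruentNumberCurve (Nat.mul_ne_zero hlp.out.ne_zero hqp.out.ne_zero)
    (rhoSubgroup (l * q)).index ≠ 1 ∧
      Nat.card (AddCommGroup.primaryComponent (congruentNumberCurve (l * q)).sha 2) = 4 ∧
      Nat.card ((congruentNumberCurve (l * q)).selmerGroup 4) = 2 ^ 6 := by
  have hlq_ne : l ≠ q := by rintro rfl; omega
  obtain ⟨hsq, -⟩ := squarefree_and_one_lt_R2 (l := l) (q := q) hlq_ne
  exact rhoIndex_ne_one_and_selmerFour_of_partner hsq hr h₂ (twoIsogenySelmerRank'_R2 hl8 hq8 hlq hql) hA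

/-- **THE HEADLINE ON R2 BY NAME.** For primes `l ≡ 1 (mod 8)`, `q ≡ 7 (mod 8)` with `(l/q) = (q/l) = 1` (the block-free two-prime sector
R2 of the census), granted GZK (`rank_eq_analyticRank_of_analyticRank_le_one`, conjunct 1 of `𝔅_ram`) and the functorial Cassels–Tate pairing
(`exists_casselsTate_pairing_adjoint ℚ`): if `ord_{s=1} L(E_{lq}, s) = 1` and `#Sel₂(E_{lq}) = 2⁵`, then

  `Ш(A_{lq})[2] = 0  ⟺  ρ(lq) ≠ 0 ∧ #Sel₄(E_{lq}) = 2⁶`,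

with BOTH isogeny Selmer dimensions (`dim S = 3`, `dim S' = 2`) DISCHARGED by the theorems of §8–§9. So on R2 the `Sel₄` hypothesis of C⁺ is the
pair («`ρ = 1`», «`dim Sel₂(A_{lq}/ℚ) = 2`»). [cite: MilneADT2006, Ch. I, Thm. 6.13(a), Rem. 6.10(a)] [cite: Darmon2004, Thm. 3.22]
[cite: SilvermanAEC2009, Thm. X.4.2(a), Prop. X.4.9] [cite: TianYuanZhang2017, §1 (ρ(n))] -/
theorem partner_sha_two_eq_bot_iff_R2 (hGZK : rank_eq_analyticRank_of_analyticRank_le_one)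
    (hCT : exists_casselsTate_pairing_adjoint ℚ) (hl8 : l % 8 = 1) (hq8 : q % 8 = 7)
    (hlq : IsSquare ((l : ℤ) : ZMod q)) (hql : IsSquare ((q : ℤ) : ZMod l))
    (hr1 : haveI := isElliptic_congruentNumberCurve (Nat.mul_ne_zero hlp.out.ne_zero hqp.out.ne_zero);
      (congruentNumberCurve (l * q)).analyticRank = 1)
    (h₂ : haveI := isElliptic_congruentNumberCurve (Nat.mul_ne_zero hlp.out.ne_zero hqp.out.ne_zero);
      Nat.card ((congruentNumberCurve (l * q)).selmerGroup 2) = 2 ^ 5) :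
    haveI := isElliptic_congruentNumberCurve (Nat.mul_ne_zero hlp.out.ne_zero hqp.out.ne_zero)
    (∀ c ∈ (congruentNumberCurve (l * q)).twoIsogenyCodomain.sha, 2 • c = 0 → c = 0) ↔
      ((rhoSubgroup (l * q)).index ≠ 1 ∧ Nat.card ((congruentNumberCurve (l * q)).selmerGroup 4) = 2 ^ 6) := by
  have hlq_ne : l ≠ q := by rintro rfl; omega
  obtain ⟨hsq, h1⟩ := squarefree_and_one_lt_R2 (l := l) (q := q) hlq_ne
  exact partner_sha_two_eq_bot_iff_of_facts hGZK hCT hsq h1 hr1 (twoIsogenySelmerRank_R2 hl8 hq8 hlq hql)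
    (twoIsogenySelmerRank'_R2 hl8 hq8 hlq hql) h₂

end R2Headline

end Summit.BirchSwinnertonDyer.PrintCf2.PartnerSha

end
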